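import Summits.Ventures.CertifiedQuantumChemistry.Rows.OrbitalRotationCovariance
import Summits.Ventures.CertifiedQuantumChemistry.Rows.OrbitalRotationEnergy
import Literature.MathematicalPhysics.QuantumChemistry.RelaxationEnergyHierarchy
import HarnessLib

/-!
# Ventures/CertifiedQuantumChemistry — Rows/OrbitalRotationInvariance.lean: the `S_z`-sector DQG
# programme and the optimal values `E_PQG` are INVARIANT under orbital rotations

HONEST FRAMING (verbatim): certified bounds for a stated model Hamiltonian in a stated basis; not a
claim about the real molecule beyond that model.

Seat rdm-B, ROWS courtesy file (theorems only; no `def`, no notation); third part of the orbital-rotation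
set (`Rows/OrbitalRotationCovariance.lean`: `IsDQGFeasible` invariant, the cones congruent;
`Rows/OrbitalRotationEnergy.lean`: `rdmEnergy` covariant with rotated integral tables). Here:

* `mul_spinDiagonal_comm`, `trace_mul_conj_of_comm(₂)`, `sum_spin_diag_eq_trace`,
  `sum_sum_spin_diag_eq_trace` — the spin-resolved trace rows of Mazziotti 2007 §II.F eqs. (87)–(90)
  are traces against the spin projectors `P_σ` (resp. `P_σ ⊗ P_τ`), which commute with every
  SPIN-PRESERVING `U` (`U_{iσ,kτ} = 0` for `σ ≠ τ`), so `Tr(P · UMU†) = Tr(P · M)`;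
* **`isDQGFeasibleSector_conj_unitary`** — THE `S_z`-SECTOR FEASIBLE SET IS INVARIANT under every
  spin-preserving unitary rotation of the spin orbitals (independent `α` / `β` rotations allowed):
  `IsDQGFeasibleSector a b γ Γ → IsDQGFeasibleSector a b (UγU†) ((U⊗U)Γ(U⊗U)†)`;
* **`pqgSectorEnergy_conj_orbital`**, **`pqgEnergy_conj_orbital`** — THE OPTIMAL VALUES ARE
  ORBITAL-ROTATION INVARIANTS OF THE INTEGRAL TABLES: for a unitary `u` on `Λ` with spin-free lift `U`,
  `E_PQG(h, g; N_α, N_β) = E_PQG(h', g'; N_α, N_β)` and `E_PQG(h, g; N) = E_PQG(h', g'; N)` with the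
  rotated tables `h' = (u_{pa} ū_{qb} h_{pq})`-contraction, `g'` likewise (the feasible set is mapped
  onto itself by `U` and back by `U†`, the functional is covariant) — the typer's §7 values
  `pqgSectorEnergy` / `pqgEnergy` depend on `(h, g)` only through the unitary-equivalence class, in
  particular not on the choice between canonical, localised or symmetry-adapted orbitals spanning the
  same one-particle space.

READING: statements about ABSTRACT feasible sets and optimal values; no certificate sentence, no row /
hint / claim node depends on them. With `Rows/OrbitalSignBlockingLossless(T).lean` they are the
mathematics behind 'rotate to a symmetry-adapted basis, then block': both steps lose nothing.
Everything is PROVED (0 sorry, standard axioms); no definitions, no named facts. NOT here: the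
`T1`/`T2′` rung; the exact side `E₀(Ĥ(h', g')) = E₀(Ĥ(h, g))` (Bogoliubov lift on the Fock space).

References: D. A. Mazziotti, in *Reduced-Density-Matrix Mechanics*, Adv. Chem. Phys. 134 (Wiley 2007)
ch. 3 §II.B, §II.F eqs. (87)–(90); P. W. Ayers, E. R. Davidson, ibid. ch. 16 §III.F eqs. (56)–(57)
(PDF p. 462); M. Nakata et al., J. Chem. Phys. 128 (2008) 164113 §II.C (the values `E_PQG`).

Tree (REUSED): `isDQGFeasible_conj_unitary`, `kronecker_mul_conjTranspose_of_unitary`, `mul_mul_apply`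
(`Rows/OrbitalRotationCovariance`); `rdmEnergy_conj_orbital`, `spin_sel_of_orbital` (`Rows/OrbitalRotationEnergy`), `sum_orb_eq_sum_sum`
(`QuantumLattice.FreeFermionSpinTwistedTraceFormula`); `IsDQGFeasibleSector` (`VariationalRDMRelaxation`); `pqgSectorEnergy`,
`pqgEnergy` (`RelaxationEnergyHierarchy`). Mathlib: `Matrix.diagonal_kronecker_diagonal`,
`Matrix.trace_mul_cycle'`, `mul_eq_one_comm`.
-/

noncomputable section

namespace Summit.Ventures.CertifiedQuantumChemistry

open Matrix Finset
open Literature.MathematicalPhysics.QuantumLattice Literature.MathematicalPhysics.QuantumChemistry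
open scoped ComplexOrder Kronecker

variable {Λ : Type*} [LinearOrder Λ] [Fintype Λ]

/-! ## §1 Spin-preserving rotations and the spin projectors -/

/-- A spin-preserving matrix commutes with the spin projector `P_σ = diag[spin = σ]`. -/
theorem mul_spinDiagonal_comm {U : Matrix (Orb Λ) (Orb Λ) ℂ}
    (hspin : ∀ i k : Orb Λ, (ofLex i).2 ≠ (ofLex k).2 → U i k = 0) (σ : Fin 2) :
    Matrix.diagonal (fun i : Orb Λ => if (ofLex i).2 = σ then (1 : ℂ) else 0) * U =
      U * Matrix.diagonal (fun i : Orb Λ => if (ofLex i).2 = σ then (1 : ℂ) else 0) := by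
  ext i k
  rw [diagonal_mul, mul_diagonal]
  by_cases hi : (ofLex i).2 = σ <;> by_cases hk : (ofLex k).2 = σ
  · simp only [hi, hk, if_true, one_mul, mul_one]
  · rw [hspin i k (by rw [hi]; exact Ne.symm hk), mul_zero, zero_mul]
  · rw [hspin i k (by rw [hk]; exact hi), mul_zero, zero_mul]
  · simp only [hi, hk, if_false, zero_mul, mul_zero]

/-- The trace against a matrix commuting with `U` is invariant under the congruence by a unitary
`U`: `Tr(P · UMU†) = Tr(P · M)`. -/
theorem trace_mul_conj_of_comm {P U : Matrix (Orb Λ) (Orb Λ) ℂ} (hPU : P * U = U * P)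
    (hU' : Uᴴ * U = 1) (M : Matrix (Orb Λ) (Orb Λ) ℂ) :
    Matrix.trace (P * (U * M * Uᴴ)) = Matrix.trace (P * M) := by
  rw [Matrix.trace_mul_cycle', ← Matrix.mul_assoc P U M, hPU, Matrix.mul_assoc U P M,
    ← Matrix.mul_assoc Uᴴ U, hU', Matrix.one_mul]

/-- The same on the pair space. -/
theorem trace_mul_conj_of_comm₂ {P W : Matrix (Orb Λ × Orb Λ) (Orb Λ × Orb Λ) ℂ} (hPW : P * W = W * P)
    (hW' : Wᴴ * W = 1) (M : Matrix (Orb Λ × Orb Λ) (Orb Λ × Orb Λ) ℂ) :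
    Matrix.trace (P * (W * M * Wᴴ)) = Matrix.trace (P * M) := by
  rw [Matrix.trace_mul_cycle', ← Matrix.mul_assoc P W M, hPW, Matrix.mul_assoc W P M,
    ← Matrix.mul_assoc Wᴴ W, hW', Matrix.one_mul]

/-- A spin-resolved trace of the 1-matrix as a trace against the spin projector. -/
theorem sum_spin_diag_eq_trace (γ : Matrix (Orb Λ) (Orb Λ) ℂ) (σ : Fin 2) :
    ∑ x : Λ, γ (orb x σ) (orb x σ) =
      Matrix.trace (Matrix.diagonal (fun i : Orb Λ => if (ofLex i).2 = σ then (1 : ℂ) else 0) * γ) := by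
  simp only [Matrix.trace, Matrix.diag, diagonal_mul]
  rw [sum_orb_eq_sum_sum]
  refine Finset.sum_congr rfl fun x _ => ?_
  simp only [ofLex_toLex, ite_mul, one_mul, zero_mul, Finset.sum_ite_eq', Finset.mem_univ, if_true]

/-- A spin-block trace of the 2-matrix as a trace against a product of spin projectors. -/
theorem sum_sum_spin_diag_eq_trace (Γ : Matrix (Orb Λ × Orb Λ) (Orb Λ × Orb Λ) ℂ) (σ τ : Fin 2) :
    ∑ x : Λ, ∑ y : Λ, Γ (orb x σ, orb y τ) (orb x σ, orb y τ) =
      Matrix.trace (Matrix.diagonal (fun i : Orb Λ => if (ofLex i).2 = σ then (1 : ℂ) else 0) ⊗ₖ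
          Matrix.diagonal (fun i : Orb Λ => if (ofLex i).2 = τ then (1 : ℂ) else 0) * Γ) := by
  rw [diagonal_kronecker_diagonal]
  simp only [Matrix.trace, Matrix.diag, diagonal_mul]
  rw [Fintype.sum_prod_type, sum_orb_eq_sum_sum]
  refine Finset.sum_congr rfl fun x _ => ?_
  simp only [ofLex_toLex, ite_mul, one_mul, zero_mul, Finset.sum_ite_irrel, Finset.sum_const_zero,
    Finset.sum_ite_eq', Finset.mem_univ, if_true]
  rw [sum_orb_eq_sum_sum]
  refine Finset.sum_congr rfl fun y _ => ?_
  rw [Finset.sum_eq_single τ]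
  · exact (if_pos rfl).symm
  · exact fun τ' _ hne => if_neg hne
  · exact fun h => (h (Finset.mem_univ τ)).elim

/-! ## §2 Invariance of the `S_z`-sector feasible set -/

/-- **The sector-DQG feasible set is invariant under SPIN-PRESERVING unitary rotations of the
spin-orbital basis** (`U U† = 1`, `U_{iσ,kτ} = 0` for `σ ≠ τ`; independent rotations of the `α` and
`β` orbitals are allowed): the `S_z` selection rule survives because `U` does not mix spins, and each
spin-resolved trace row is a trace against a spin projector commuting with `U` (resp. `U⊗U`). -/
theorem isDQGFeasibleSector_conj_unitary {U : Matrix (Orb Λ) (Orb Λ) ℂ} (hU : U * Uᴴ = 1)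
    (hspin : ∀ i k : Orb Λ, (ofLex i).2 ≠ (ofLex k).2 → U i k = 0) {a b : ℕ}
    {γ : Matrix (Orb Λ) (Orb Λ) ℂ} {Γ : Matrix (Orb Λ × Orb Λ) (Orb Λ × Orb Λ) ℂ}
    (h : IsDQGFeasibleSector a b γ Γ) :
    IsDQGFeasibleSector a b (U * γ * Uᴴ) (U ⊗ₖ U * Γ * (U ⊗ₖ U)ᴴ) := by
  have hU' : Uᴴ * U = 1 := mul_eq_one_comm.mp hU
  have hW' : (U ⊗ₖ U)ᴴ * (U ⊗ₖ U) = 1 := by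
    rw [conjTranspose_kronecker, ← mul_kronecker_mul, hU', one_kronecker_one]
  have hP := mul_spinDiagonal_comm hspin
  have hP₂ : ∀ σ τ : Fin 2,
      Matrix.diagonal (fun i : Orb Λ => if (ofLex i).2 = σ then (1 : ℂ) else 0) ⊗ₖ
          Matrix.diagonal (fun i : Orb Λ => if (ofLex i).2 = τ then (1 : ℂ) else 0) * (U ⊗ₖ U) =
        U ⊗ₖ U * (Matrix.diagonal (fun i : Orb Λ => if (ofLex i).2 = σ then (1 : ℂ) else 0) ⊗ₖ
          Matrix.diagonal (fun i : Orb Λ => if (ofLex i).2 = τ then (1 : ℂ) else 0)) := fun σ τ => by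
    rw [← mul_kronecker_mul, ← mul_kronecker_mul, hP σ, hP τ]
  -- the selection rule on spin orbitals
  have hγ : ∀ y x : Orb Λ, (ofLex y).2 ≠ (ofLex x).2 → γ y x = 0 := fun y x hyx =>
    h.spin_sel (ofLex y).1 (ofLex x).1 (ofLex y).2 (ofLex x).2 hyx
  refine
    { dqg := isDQGFeasible_conj_unitary hU h.dqg, spin_sel := ?_, trace_up := ?_, trace_down := ?_,
      trace_upUp := ?_, trace_downDown := ?_, trace_upDown := ?_ }
  · intro p q σ τ hστ
    rw [mul_mul_apply]
    refine Finset.sum_eq_zero fun x _ => Finset.sum_eq_zero fun y _ => ?_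
    by_cases hy : (ofLex y).2 = σ
    · by_cases hx : (ofLex x).2 = τ
      · rw [hγ y x (by rw [hy, hx]; exact hστ), mul_zero, zero_mul]
      · rw [conjTranspose_apply, hspin (orb q τ) x (by rw [ofLex_toLex]; exact Ne.symm hx), star_zero,
          mul_zero]
    · rw [hspin (orb p σ) y (by rw [ofLex_toLex]; exact Ne.symm hy), zero_mul, zero_mul]
  · rw [sum_spin_diag_eq_trace, trace_mul_conj_of_comm (hP 0) hU', ← sum_spin_diag_eq_trace]
    exact h.trace_up
  · rw [sum_spin_diag_eq_trace, trace_mul_conj_of_comm (hP 1) hU', ← sum_spin_diag_eq_trace]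
    exact h.trace_down
  · rw [sum_sum_spin_diag_eq_trace, trace_mul_conj_of_comm₂ (hP₂ 0 0) hW', ← sum_sum_spin_diag_eq_trace]
    exact h.trace_upUp
  · rw [sum_sum_spin_diag_eq_trace, trace_mul_conj_of_comm₂ (hP₂ 1 1) hW', ← sum_sum_spin_diag_eq_trace]
    exact h.trace_downDown
  · rw [sum_sum_spin_diag_eq_trace, trace_mul_conj_of_comm₂ (hP₂ 0 1) hW', ← sum_sum_spin_diag_eq_trace]
    exact h.trace_upDown

/-! ## §3 Invariance of the optimal values -/

/-- **THE DQG LOWER BOUND IS AN ORBITAL-ROTATION INVARIANT (sector form).** For a unitary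
one-particle matrix `u` with spin-free lift `U`: `E_PQG(h, g; N_α, N_β) = E_PQG(h', g'; N_α, N_β)`
with the rotated integral tables of `rdmEnergy_conj_orbital` — the optimal value of the sector
programme depends on the integral tables only through their unitary-equivalence class
(the feasible set is invariant, the functional covariant). -/
theorem pqgSectorEnergy_conj_orbital {U : Matrix (Orb Λ) (Orb Λ) ℂ} {u : Matrix Λ Λ ℂ}
    (hU : U * Uᴴ = 1) (hUu : ∀ p q σ τ, U (orb p σ) (orb q τ) = if σ = τ then u p q else 0)
    (h : Λ → Λ → ℂ) (g : Λ → Λ → Λ → Λ → ℂ) (hnuc : ℂ) (a b : ℕ) :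
    pqgSectorEnergy h g hnuc a b =
      pqgSectorEnergy (fun a b => ∑ p, ∑ q, u p a * star (u q b) * h p q)
        (fun a b c d => ∑ p, ∑ q, ∑ r, ∑ s, u p a * star (u q b) * u r c * star (u s d) * g p q r s)
        hnuc a b := by
  have hspin := spin_sel_of_orbital hUu
  have hU' : Uᴴ * U = 1 := mul_eq_one_comm.mp hU
  have hW : U ⊗ₖ U * (U ⊗ₖ U)ᴴ = 1 := kronecker_mul_conjTranspose_of_unitary hU U hU
  have hW' : (U ⊗ₖ U)ᴴ * (U ⊗ₖ U) = 1 := mul_eq_one_comm.mp hW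
  unfold pqgSectorEnergy
  congr 1
  ext E
  constructor
  · rintro ⟨γ, Γ, hf, rfl⟩
    refine ⟨Uᴴ * γ * U, (U ⊗ₖ U)ᴴ * Γ * (U ⊗ₖ U), ?_, ?_⟩
    · have hf' := isDQGFeasibleSector_conj_unitary (U := Uᴴ) (by rw [conjTranspose_conjTranspose, hU'])
        (fun i k hik => by rw [conjTranspose_apply, hspin k i (Ne.symm hik), star_zero]) hf
      simpa only [conjTranspose_conjTranspose, ← conjTranspose_kronecker] using hf'
    · have hγ : U * (Uᴴ * γ * U) * Uᴴ = γ := by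
        simp only [← Matrix.mul_assoc]
        rw [hU, Matrix.one_mul, Matrix.mul_assoc, hU, Matrix.mul_one]
      have hΓ : U ⊗ₖ U * ((U ⊗ₖ U)ᴴ * Γ * (U ⊗ₖ U)) * (U ⊗ₖ U)ᴴ = Γ := by
        simp only [← Matrix.mul_assoc]
        rw [hW, Matrix.one_mul, Matrix.mul_assoc, hW, Matrix.mul_one]
      rw [← rdmEnergy_conj_orbital hUu, hγ, hΓ]
  · rintro ⟨γ, Γ, hf, rfl⟩
    exact ⟨U * γ * Uᴴ, U ⊗ₖ U * Γ * (U ⊗ₖ U)ᴴ, isDQGFeasibleSector_conj_unitary hU hspin hf,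
      by rw [rdmEnergy_conj_orbital hUu]⟩

/-- **THE DQG LOWER BOUND IS AN ORBITAL-ROTATION INVARIANT (`N`-electron form).** -/
theorem pqgEnergy_conj_orbital {U : Matrix (Orb Λ) (Orb Λ) ℂ} {u : Matrix Λ Λ ℂ}
    (hU : U * Uᴴ = 1) (hUu : ∀ p q σ τ, U (orb p σ) (orb q τ) = if σ = τ then u p q else 0)
    (h : Λ → Λ → ℂ) (g : Λ → Λ → Λ → Λ → ℂ) (hnuc : ℂ) (N : ℕ) :
    pqgEnergy h g hnuc N =
      pqgEnergy (fun a b => ∑ p, ∑ q, u p a * star (u q b) * h p q)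
        (fun a b c d => ∑ p, ∑ q, ∑ r, ∑ s, u p a * star (u q b) * u r c * star (u s d) * g p q r s)
        hnuc N := by
  have hU' : Uᴴ * U = 1 := mul_eq_one_comm.mp hU
  have hW : U ⊗ₖ U * (U ⊗ₖ U)ᴴ = 1 := kronecker_mul_conjTranspose_of_unitary hU U hU
  unfold pqgEnergy
  congr 1
  ext E
  constructor
  · rintro ⟨γ, Γ, hf, rfl⟩
    refine ⟨Uᴴ * γ * U, (U ⊗ₖ U)ᴴ * Γ * (U ⊗ₖ U), ?_, ?_⟩
    · have hf' := isDQGFeasible_conj_unitary (U := Uᴴ) (by rw [conjTranspose_conjTranspose, hU']) hf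
      simpa only [conjTranspose_conjTranspose, ← conjTranspose_kronecker] using hf'
    · have hγ : U * (Uᴴ * γ * U) * Uᴴ = γ := by
        simp only [← Matrix.mul_assoc]
        rw [hU, Matrix.one_mul, Matrix.mul_assoc, hU, Matrix.mul_one]
      have hΓ : U ⊗ₖ U * ((U ⊗ₖ U)ᴴ * Γ * (U ⊗ₖ U)) * (U ⊗ₖ U)ᴴ = Γ := by
        simp only [← Matrix.mul_assoc]
        rw [hW, Matrix.one_mul, Matrix.mul_assoc, hW, Matrix.mul_one]
      rw [← rdmEnergy_conj_orbital hUu, hγ, hΓ]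
  · rintro ⟨γ, Γ, hf, rfl⟩
    exact ⟨U * γ * Uᴴ, U ⊗ₖ U * Γ * (U ⊗ₖ U)ᴴ, isDQGFeasible_conj_unitary hU hf,
      by rw [rdmEnergy_conj_orbital hUu]⟩

end Summit.Ventures.CertifiedQuantumChemistry

end
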